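import Literature.MathematicalPhysics.QuantumFieldTheory.Balaban1983to89.HiggsFluctMeasureWickPairings
import Literature.MathematicalPhysics.QuantumFieldTheory.Balaban1983to89.B1Eq323DisplayedCumulantBound
import Literature.MathematicalPhysics.QuantumFieldTheory.Balaban1983to89.B3FluctFieldWickSum
import Literature.MathematicalPhysics.QuantumFieldTheory.Balaban1983to89.B3ScalarPropagatorWickSum
import Literature.MathematicalPhysics.QuantumFieldTheory.Balaban1983to89.HiggsFluctMeasureWickMomentBound
import Literature.MathematicalPhysics.QuantumFieldTheory.Balaban1983to89.B1Eq324SmallFieldLeafModels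

/-!
# `Balaban1983to89.HiggsFluctMeasureWickPairingsModels` — T. Bałaban, *(Higgs)₂,₃ quantum fields in a finite volume* I
[Balaban1982Higgs1] (3.56) p. 622 / p. 617 *"independent Gaussian random variables with the covariances C^{(j),L^jε}"* and
III [Balaban1983Higgs3] (1.4) p. 414 *"divided into pairs and each pair is replaced by the corresponding propagator"*, p. 416
*"graphs of the expansion of G^ε"*; Glimm–Jaffe [GlimmJaffeQP1987] (8.2.4), (3.2.12) — **THE PAIR-PARTITION (PERFECT-MATCHING)
FORM OF WICK'S THEOREM, ITS CONNECTED (TRUNCATED) FORM AND THE EVEN MOMENTS `(2n−1)!!·σ²ⁿ` ON THE THREE GAUSSIAN LAWS OF THE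
(Higgs)₂,₃ CONSTRUCTION THAT THE TREE INTEGRATES AGAINST**: the law of (3.56) `dμ_{C^{(k)}}(A′)dμ_{C^{(k)}(B^{(k+1)})}(φ′)` (r14's
`law356` presentation as p13's `gexp blockPrec`), the multiscale field `A′ = Σ_j A′^{(j)}` of III (1.4) (`Π_j dμ_{C^{(j),L^jη}}`,
propagator `G_k`), and the scalar fluctuation `χ` on `Ω = B^k(Ω^{(k)})` (propagator `G_k(Ω,B̃)`).

statement-level skeleton of published theorems with citation tags; proofs where landed; nothing here is a claim about the Yang–Mills mass gap

CITATION HEADER (lean-in-tree rule).  lit-balaban typed skeleton (HOME `run/shared/lean/pub/lit-balaban/`), typer line, unit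
`lit-balaban-typer` gen 35 (`literature-prover-lit-balaban-typer-g35-0`); the MODEL-INSTANCE LEAF of the typer's
`HiggsFluctMeasureWickPairings` (same gen).  v1.1 (typer gen 36, `literature-prover-lit-balaban-typer-g36-0`, 2026-08-25): APPEND-ONLY
§4 — the Gaussian product-moment bound of the typer's `HiggsFluctMeasureWickMomentBound` (p399568) ON THE LAW OF (3.56) and its
scale/volume-uniform form from the Prop. 2.3 (2.33) lower halves (row **B1.Prop2.3**, r14, consumed BY NAME through r14's
`B1Eq324SmallFieldLeaf.{bondVar, siteVar, bondVar_le_of_ineq233_lower', siteVar_le_of_ineq233_lower'}` and p29's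
`B1Eq324SmallFieldLeafModels.{bondVar_le_zeroField, siteVar_le_zeroField}`); every v1 declaration byte-identical; two imports added.  Located member of the SKELETON rows **B1.Eq3.56** / **B1.Eq3.57** (fold owner r12,
PROXY r14) and **B3.Eq1.4**, **B3.Eq1.12-1.15**, **B3.Eq1.17-1.18**, **B3.Eq1.19-1.22** (fold owner r15) — CELLS ONLY, zero head
weight.  USED BY NAME, nothing re-declared or edited: r14 g26's `B1Eq323DisplayedCumulantBound.{blockPrec, blockPrec_posDef, Ψ,
legVecS, dotProduct_legVecS, integral_law356_eq_gexp, propKer, integral_legVal_mul_legVal}` (p396542), the typer's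
`B1Eq357FluctuationPolynomial.law356` (g33), p14's `B1Prop32InteractionBound.{Leg, legVal}`, the typer g30's
`B3FluctFieldWickSum.integral_prodPairs_eq_wickSum` and `B3ScalarPropagatorWickSum.integral_prodExtLegs_eq_wickSum`, p33's
`B3GaussianPerturbationGraphs.{gexp_two_legs, obsW}`, p13's `LegDiagram.{legs, diags, dval, IsConn}` / `ursellOf`, and the typer g35's
`HiggsFluctMeasureWickPairings.{pairPartitions, pairVal, gexp_prod_legs_eq_wickSum, wickSum_congr,
wickSum_eq_sum_pairPartitions_pairVal, wickSum_eq_zero_of_odd, wickSum_const_eq, ursellOf_wickSum_legs}`.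

THE SOURCE TEXTS (as quoted and located in the files named): I p. 622 (3.56) *"∫dμ_{C^{(k)}}(A′)∫dμ_{C^{(k)}(B^{(k+1)})}(φ′)…"*
(r14's `B1Eq356FluctuationIntegral` / the typer's `B1Eq357FluctuationPolynomial`); I p. 617 [PDF 15] L30–31 (text layer
`paper:balaban1982-cmp85-higgs23-i` p0015, read this session): *"The fields A′_j defining the components of (3.33) are independent
Gaussian random variables with the covariances C^{(j),L^jε}."*; III p. 414 / p. 416 as quoted in `HiggsFluctMeasureWickPairings`;
Glimm–Jaffe (8.2.4) / (3.2.12) ibid.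

WHAT THIS FILE PROVES (kernel-checked, zero `sorry`, standard axioms; theorems only, no definition, no `Prop`-valued fact).
* §1 THE LAW OF (3.56) (`μ₀², m² > 0`, `a > 0`, `L > 1`, `k ≤ K`; leg index types in `Type`, as p13's `gexp`):
  `inv_blockPrec_legVecS_dotProduct` (the covariance of r14's Gaussian presentation on two legs IS `(L^kε)^{d−2}×` r14's kernel
  `propKer` — (2.30) for two `A′`-legs, (2.32) for two `φ′`-legs, `0` for a mixed pair), **`integral_prod_legVal_law356_eq_wickSum`**
  (WICK'S THEOREM FOR THE LAW OF (3.56) IN PAIRING FORM: every mixed moment of the unit-lattice legs (1.22)/(3.57) is the pairing sum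
  with these pair values), `integral_prod_legVal_law356_eq_sum_pairPartitions`, `integral_prod_legVal_law356_eq_zero_of_odd`, and
  **`ursellOf_integral_prod_legVal_law356`** (the TRUNCATED moments of leg products grouped in clusters are the sums over the
  CONNECTED pairings — the combinatorial half of p. 616 *"⟨Vⁿ⟩^T is the expression corresponding to the sum of connected graphs"*
  at the level of the legs); `integral_legVal_pow_two_mul_law356` / `integral_legVal_pow_odd_law356` (one leg: `(2n−1)‼·σ²ⁿ`, `0`).
* §2 THE MULTISCALE FIELD `A′` OF III (1.4) (`msq > 0`, `a > 0`, `L > 1`, `1 ≤ k ≤ K`): **`integral_prodPairs_eq_sum_pairPartitions`**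
  (`∫ Π_{i∈s}⟨A′,f_i⟩ Π_j dμ = Σ_{π ∈ pairPartitions s} Π_{{a<b}∈π} ⟨f_b, G_k f_a⟩`), `integral_prodPairs_eq_zero_of_odd`,
  **`integral_fluctSum_pow_two_mul`** (`∫⟨A′,f⟩^{2n} Π_j dμ = (2n−1)‼·⟨f, G_k f⟩ⁿ`), `integral_fluctSum_pow_odd`,
  **`ursellOf_integral_prodPairs_eq_sum_connected`** (truncated moments of `A′`-leg products = sums over CONNECTED pairings with
  propagator `G_k` — p. 416 *"graphs of the expansion of G^ε"* for the actual multiscale field).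
* §3 THE SCALAR FLUCTUATION `χ` (`msq > 0`, `a_k ≥ 0`, legs supported in `Ω`): **`integral_prodExtLegs_eq_sum_pairPartitions`**,
  `integral_prodExtLegs_eq_zero_of_odd`.
* §4 (v1.1) THE PRODUCT-MOMENT BOUND ON THE LAW OF (3.56): `propKer_inr_self` / `propKer_inl_self` (the diagonal of r14's kernel =
  r14's `bondVar` / `siteVar T^{(k)}`), `mesh_pow_mul_propKer_self_nonneg`, `propKer_self_nonneg`, **`abs_mesh_pow_mul_propKer_le`** /
  **`abs_propKer_le`** (Cauchy–Schwarz `|C(b,b′)| ≤ C(b,b)^{1/2}C(b′,b′)^{1/2}` for the two covariances (2.30)/(2.32)),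
  **`abs_integral_prod_legVal_law356_le`** (`|∫ Π_{i∈T} legVal(lab i) d(law356)| ≤ (|T|−1)‼·Π_i σ_i`, `σ_i² = (L^kε)^{d−2}propKer_{ii}`),
  **`abs_integral_prod_legVal_law356_le_of_var`** (variance bounds `bondVar ≤ σ_A²(L^kε)^{−(d−2)}`, `siteVar ≤ σ_φ²(L^kε)^{−(d−2)}` ⇒
  `≤ (|T|−1)‼·max(σ_A²,σ_φ²)^{|T|/2}`, independent of `k`, `ε`, the volume), **`abs_integral_prod_legVal_law356_le_of_ineq233`** (the same from
  the two (2.33) lower halves as displayed INPUTS, `σ² = γ⁻¹`), **`abs_integral_prod_legVal_law356_le_zeroField`** (HYPOTHESIS-FREE at zero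
  background on the whole torus, `k < K`, `L^kε ≤ 1`: `σ² = L²/min{a,8γ₀}` by p29's variance bounds), `integral_legVal_pow_two_mul_law356_le_of_var`
  (`∫ legVal^{2n} ≤ (2n−1)‼·max(σ_A²,σ_φ²)ⁿ`).
HONEST SCOPE.  Bookkeeping corollaries of the typer's `HiggsFluctMeasureWickPairings` on the laws of record; §4's bound is the crude
local one (no decay between distinct legs — the cell's connected-graph estimates, r14's `B1Eq323ConnectedGraphBound` /
`B1Eq323DisplayedCumulantBound`, keep the decay of (2.34)); the only analytic input of §4 is the (2.33) lower half, displayed as a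
hypothesis or discharged by the cell's instance files BY NAME; rows keep their heads; NOT summit progress; NOT Clay.
-/

open Finset
open scoped BigOperators Nat

namespace Literature.MathematicalPhysics.QuantumFieldTheory.Balaban1983to89.HiggsFluctMeasureWickPairingsModels

open _root_.MeasureTheory Matrix
open HiggsLattice (ChargeData siteInner)
open B3MultiscaleFields (toSite)
open HiggsFluctMeasure (fluctMeasure fluctCov)
open HiggsCondGauss228 (fieldOfCrd)
open Literature.MathematicalPhysics.QuantumFieldTheory.BalabanImbrieJaffe1984to88.BIJ88TruncationConnected306 (gexp)
open B3GaussianPerturbationGraphs (gexp_two_legs)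
open B1Prop32InteractionBound (Leg legVal)
open B1Eq357FluctuationPolynomial (law356)
open B1Eq323DisplayedCumulantBound (blockPrec blockPrec_posDef Ψ legVecS dotProduct_legVecS integral_law356_eq_gexp propKer
  integral_legVal_mul_legVal)
open HiggsFluctMeasureWickSum (wickSum)
open HiggsFluctMeasureWickPairings (pairPartitions pairVal gexp_prod_legs_eq_wickSum wickSum_congr wickSum_eq_sum_pairPartitions_pairVal
  wickSum_eq_zero_of_odd wickSum_const_eq)

noncomputable section

/-! ## §1 The law of (3.56): Wick's theorem in pairing form, pair values = the covariance kernels (2.30)/(2.32), mixed pairs `0` -/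

section Law356

variable {P : HiggsLattice.Params} {N : ℕ} (C : ChargeData N) (Ω : Finset (HiggsLattice.Site P 0)) (B : HiggsLattice.VecField P 0)
  {μ0sq msq a : ℝ} {k : ℕ}

open Classical in
/-- **The covariance of p13's Gaussian presentation of the law of (3.56) on two legs IS `(L^kε)^{d−2}×` the covariance kernel**
(`propKer`: (2.30) for two `A′`-legs, (2.32) for two `φ′`-legs, `0` for a mixed pair — independence):
`⟨blockPrec⁻¹ v_{l,y}, v_{l′,y′}⟩ = (L^kε)^{d−2}·propKer l y l′ y′` (r14's `integral_law356_eq_gexp` + `gexp_two_legs` +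
`integral_legVal_mul_legVal`). [cite: Balaban1982Higgs1, (3.56) p.622] -/
theorem inv_blockPrec_legVecS_dotProduct (hμ : 0 < μ0sq) (hmsq : 0 < msq) (ha : 0 < a) (hL : 1 < (P.L : ℝ)) (hk : k ≤ P.K)
    (l l' : Leg N P.d) (y y' : HiggsLattice.Site P k) :
    ((blockPrec C Ω B μ0sq msq a k)⁻¹ *ᵥ legVecS k l y) ⬝ᵥ legVecS k l' y'
      = P.mesh k ^ ((P.d : ℝ) - 2) * propKer C Ω B μ0sq msq a k l y l' y' := by
  classical
  have h1 := integral_law356_eq_gexp C Ω B hμ hmsq ha hL hk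
    (fun ω => legVal k ω.1 (fieldOfCrd Finset.univ ω.2) l y * legVal k ω.1 (fieldOfCrd Finset.univ ω.2) l' y')
  have h2 := integral_legVal_mul_legVal C Ω B hμ hmsq ha hL hk l l' y y'
  rw [h1] at h2
  simp only [← dotProduct_legVecS] at h2
  rwa [gexp_two_legs (blockPrec_posDef C Ω B hμ hmsq ha hL hk)] at h2

/-- **WICK'S THEOREM FOR THE LAW OF (3.56) IN PAIRING FORM**: under `dμ_{C^{(k)}}(A′)dμ_{C^{(k)}(B^{(k+1)})}(φ′)` every mixed
moment of the unit-lattice legs (1.22)/(3.57) (`legVal`: `A′(⟨y,μ⟩)` or `φ′_j(y)`, rescaled) is the sum over the pairings of the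
legs, a pair contributing `(L^kε)^{d−2}×` its covariance kernel — (2.30) for two `A′`-legs, (2.32) for two `φ′`-legs, `0` for a
mixed pair (the two Gaussian factors are independent): `∫ Π_{i∈T} legVal(lab i) d(law356) = wickSum (fun i i′ ↦
(L^kε)^{d−2}·propKer (lab i) (lab i′)) T` (`μ₀², m² > 0`, `a > 0`, `L > 1`, `k ≤ K`). [cite: Balaban1982Higgs1, (3.56) p.622] -/
theorem integral_prod_legVal_law356_eq_wickSum (hμ : 0 < μ0sq) (hmsq : 0 < msq) (ha : 0 < a) (hL : 1 < (P.L : ℝ))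
    (hk : k ≤ P.K) {ι : Type} [LinearOrder ι] (lab : ι → Leg N P.d × HiggsLattice.Site P k) (T : Finset ι) :
    ∫ ω, ∏ i ∈ T, legVal k ω.1 (fieldOfCrd Finset.univ ω.2) (lab i).1 (lab i).2 ∂(law356 C Ω B μ0sq msq a k)
      = wickSum (fun i i' => P.mesh k ^ ((P.d : ℝ) - 2)
          * propKer C Ω B μ0sq msq a k (lab i).1 (lab i).2 (lab i').1 (lab i').2) T := by
  classical
  rw [integral_law356_eq_gexp C Ω B hμ hmsq ha hL hk]
  simp only [← dotProduct_legVecS]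
  have h := gexp_prod_legs_eq_wickSum (blockPrec_posDef C Ω B hμ hmsq ha hL hk) (fun i => legVecS k (lab i).1 (lab i).2) T
  have h2 : wickSum (fun i i' => ((blockPrec C Ω B μ0sq msq a k)⁻¹ *ᵥ legVecS k (lab i).1 (lab i).2) ⬝ᵥ
      legVecS k (lab i').1 (lab i').2) T = wickSum (fun i i' => P.mesh k ^ ((P.d : ℝ) - 2)
          * propKer C Ω B μ0sq msq a k (lab i).1 (lab i).2 (lab i').1 (lab i').2) T := by
    refine wickSum_congr fun i _ i' _ _ => ?_
    convert inv_blockPrec_legVecS_dotProduct C Ω B hμ hmsq ha hL hk (lab i).1 (lab i').1 (lab i).2 (lab i').2 using 3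
  rw [← h2]
  convert h using 2

/-- The same as a sum over the pair partitions of the legs. [cite: Balaban1982Higgs1, (3.56) p.622] -/
theorem integral_prod_legVal_law356_eq_sum_pairPartitions (hμ : 0 < μ0sq) (hmsq : 0 < msq) (ha : 0 < a)
    (hL : 1 < (P.L : ℝ)) (hk : k ≤ P.K) {ι : Type} [LinearOrder ι] (lab : ι → Leg N P.d × HiggsLattice.Site P k)
    (T : Finset ι) :
    ∫ ω, ∏ i ∈ T, legVal k ω.1 (fieldOfCrd Finset.univ ω.2) (lab i).1 (lab i).2 ∂(law356 C Ω B μ0sq msq a k)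
      = ∑ π ∈ pairPartitions T, ∏ Bl ∈ π, pairVal (fun i i' => P.mesh k ^ ((P.d : ℝ) - 2)
          * propKer C Ω B μ0sq msq a k (lab i).1 (lab i).2 (lab i').1 (lab i').2) Bl := by
  rw [integral_prod_legVal_law356_eq_wickSum C Ω B hμ hmsq ha hL hk, wickSum_eq_sum_pairPartitions_pairVal]

/-- An odd number of legs of (3.57) has expectation `0` under the law of (3.56). [cite: Balaban1982Higgs1, (3.56) p.622] -/
theorem integral_prod_legVal_law356_eq_zero_of_odd (hμ : 0 < μ0sq) (hmsq : 0 < msq) (ha : 0 < a) (hL : 1 < (P.L : ℝ))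
    (hk : k ≤ P.K) {ι : Type} [LinearOrder ι] (lab : ι → Leg N P.d × HiggsLattice.Site P k) {T : Finset ι}
    (hT : Odd T.card) :
    ∫ ω, ∏ i ∈ T, legVal k ω.1 (fieldOfCrd Finset.univ ω.2) (lab i).1 (lab i).2 ∂(law356 C Ω B μ0sq msq a k) = 0 := by
  rw [integral_prod_legVal_law356_eq_wickSum C Ω B hμ hmsq ha hL hk, wickSum_eq_zero_of_odd _ hT]

/-- **The even moments of one leg under the law of (3.56)**: `∫ legVal(l,y)^{2n} d(law356) = (2n−1)‼·((L^kε)^{d−2}·propKer l y l y)ⁿ`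
(Glimm–Jaffe (3.2.12) for this Gaussian law). [cite: Balaban1982Higgs1, (3.56) p.622] -/
theorem integral_legVal_pow_two_mul_law356 (hμ : 0 < μ0sq) (hmsq : 0 < msq) (ha : 0 < a) (hL : 1 < (P.L : ℝ)) (hk : k ≤ P.K)
    (l : Leg N P.d) (y : HiggsLattice.Site P k) (n : ℕ) :
    ∫ ω, legVal k ω.1 (fieldOfCrd Finset.univ ω.2) l y ^ (2 * n) ∂(law356 C Ω B μ0sq msq a k)
      = ((2 * n - 1)‼ : ℕ) * (P.mesh k ^ ((P.d : ℝ) - 2) * propKer C Ω B μ0sq msq a k l y l y) ^ n := by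
  have h := integral_prod_legVal_law356_eq_wickSum C Ω B hμ hmsq ha hL hk (fun _ : Fin (2 * n) => (l, y)) univ
  simp only [prod_const, card_univ, Fintype.card_fin] at h
  rw [h, wickSum_const_eq _ (by rw [card_univ, Fintype.card_fin]; exact even_two_mul n), card_univ, Fintype.card_fin,
    Nat.mul_div_cancel_left _ two_pos]

/-- The odd moments of one leg under the law of (3.56) vanish. [cite: Balaban1982Higgs1, (3.56) p.622] -/
theorem integral_legVal_pow_odd_law356 (hμ : 0 < μ0sq) (hmsq : 0 < msq) (ha : 0 < a) (hL : 1 < (P.L : ℝ)) (hk : k ≤ P.K)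
    (l : Leg N P.d) (y : HiggsLattice.Site P k) (n : ℕ) :
    ∫ ω, legVal k ω.1 (fieldOfCrd Finset.univ ω.2) l y ^ (2 * n + 1) ∂(law356 C Ω B μ0sq msq a k) = 0 := by
  have h := integral_prod_legVal_law356_eq_zero_of_odd C Ω B hμ hmsq ha hL hk (fun _ : Fin (2 * n + 1) => (l, y))
    (T := univ) (by rw [card_univ, Fintype.card_fin]; exact odd_two_mul_add_one n)
  simpa only [prod_const, card_univ, Fintype.card_fin] using h

end Law356

section Law356Connected

open Literature.Probability.LatticeModels (ursellOf)
open Literature.Probability.LatticeModels.LegDiagram (legs diags dval IsConn)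
open B3GaussianPerturbationGraphs (obsW)
open HiggsFluctMeasureWickPairings (ursellOf_wickSum_legs)

variable {P : HiggsLattice.Params} {N : ℕ} (C : ChargeData N) (Ω : Finset (HiggsLattice.Site P 0)) (B : HiggsLattice.VecField P 0)
  {μ0sq msq a : ℝ} {k : ℕ}

/-- **THE TRUNCATED EXPECTATIONS OF PRODUCTS OF LEGS UNDER THE LAW OF (3.56) ARE THE SUMS OVER THE CONNECTED PAIRINGS** (the
combinatorial half of p. 616 *"⟨Vⁿ⟩^T is the expression corresponding to the sum of connected graphs"* at the level of the
legs; p13's `LegDiagram.ursellOf_dmoment`): legs `lab l` grouped in clusters `own l ∈ J`, `V` a nonempty vertex family.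
[cite: Balaban1982Higgs1, (3.23) p.616; (3.56) p.622] -/
theorem ursellOf_integral_prod_legVal_law356 (hμ : 0 < μ0sq) (hmsq : 0 < msq) (ha : 0 < a) (hL : 1 < (P.L : ℝ))
    (hk : k ≤ P.K) {J : Type*} [DecidableEq J] {Λ : Type} [Fintype Λ] [LinearOrder Λ]
    (lab : Λ → Leg N P.d × HiggsLattice.Site P k) (own : Λ → J) {V : Finset (Option J)} (hV : V.Nonempty) :
    ursellOf (fun Q => ∫ ω, ∏ i ∈ legs own Q, legVal k ω.1 (fieldOfCrd Finset.univ ω.2) (lab i).1 (lab i).2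
        ∂(law356 C Ω B μ0sq msq a k)) V
      = ∑ g ∈ (diags own V).filter (IsConn own V), dval (pairVal (fun i i' => P.mesh k ^ ((P.d : ℝ) - 2)
          * propKer C Ω B μ0sq msq a k (lab i).1 (lab i).2 (lab i').1 (lab i').2)) obsW V g := by
  have h : (fun Q => ∫ ω, ∏ i ∈ legs own Q, legVal k ω.1 (fieldOfCrd Finset.univ ω.2) (lab i).1 (lab i).2
        ∂(law356 C Ω B μ0sq msq a k))
      = fun Q => wickSum (fun i i' => P.mesh k ^ ((P.d : ℝ) - 2)
          * propKer C Ω B μ0sq msq a k (lab i).1 (lab i).2 (lab i').1 (lab i').2) (legs own Q) :=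
    funext fun Q => integral_prod_legVal_law356_eq_wickSum C Ω B hμ hmsq ha hL hk lab _
  rw [h, ursellOf_wickSum_legs own _ hV]

end Law356Connected

/-! ## §2 The multiscale field `A′ = Σ_j A′^{(j)}` of III (1.4) (propagator `G_k`, `B3FluctFieldWickSum`) -/

section FluctSum

open B3MultiscaleFields (fluctPiece)
open HiggsFluctMeasure (vecG fluctFamily)
open B3FluctFieldWickSum (integral_prodPairs_eq_wickSum)
open Literature.Probability.LatticeModels (ursellOf)
open Literature.Probability.LatticeModels.LegDiagram (legs diags dval IsConn)
open B3GaussianPerturbationGraphs (obsW)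
open HiggsFluctMeasureWickPairings (ursellOf_wickSum_legs)

variable {P : HiggsLattice.Params} {msq a : ℝ}

/-- **«DIVIDED INTO PAIRS AND EACH PAIR IS REPLACED BY THE CORRESPONDING PROPAGATOR» FOR THE FIELD `A′` OF (1.4) AS A SUM OVER
PAIR PARTITIONS**: `∫ Π_{i∈s}⟨A′,f_i⟩ Π_j dμ_{C^{(j),L^jη}} = Σ_{π ∈ pairPartitions s} Π_{{a<b}∈π} ⟨f_b, G_k f_a⟩` (`msq > 0`, `a > 0`,
`L > 1`, `1 ≤ k ≤ K`; the typer g30's `integral_prodPairs_eq_wickSum` rewritten by `wickSum_eq_sum_pairPartitions_pairVal`).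
[cite: Balaban1983Higgs3, (1.4) p.414] -/
theorem integral_prodPairs_eq_sum_pairPartitions (hmsq : 0 < msq) (ha : 0 < a) (hL : 1 < (P.L : ℝ)) {k : ℕ} (hk1 : 1 ≤ k)
    (hk : k ≤ P.K) {ι : Type*} [LinearOrder ι] (f : ι → HiggsLattice.VecField P 0) (s : Finset ι) :
    ∫ F, ∏ i ∈ s, siteInner (toSite (∑ j : Fin k, fluctPiece msq a j (F j))) (toSite (f i)) ∂(fluctFamily P msq a k)
      = ∑ π ∈ pairPartitions s, ∏ Bl ∈ π,
          pairVal (fun a' b' => siteInner (toSite (f b')) (vecG P msq a k (toSite (f a')))) Bl := by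
  rw [integral_prodPairs_eq_wickSum hmsq ha hL hk1 hk f s, wickSum_eq_sum_pairPartitions_pairVal]

/-- An odd number of legs of `A′` integrates to `0`. [cite: Balaban1983Higgs3, (1.4) p.414] -/
theorem integral_prodPairs_eq_zero_of_odd (hmsq : 0 < msq) (ha : 0 < a) (hL : 1 < (P.L : ℝ)) {k : ℕ} (hk1 : 1 ≤ k)
    (hk : k ≤ P.K) {ι : Type*} [LinearOrder ι] (f : ι → HiggsLattice.VecField P 0) {s : Finset ι} (hs : Odd s.card) :
    ∫ F, ∏ i ∈ s, siteInner (toSite (∑ j : Fin k, fluctPiece msq a j (F j))) (toSite (f i)) ∂(fluctFamily P msq a k) = 0 := by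
  rw [integral_prodPairs_eq_wickSum hmsq ha hL hk1 hk f s, wickSum_eq_zero_of_odd _ hs]

/-- **The even moments of one leg of `A′`**: `∫⟨A′,f⟩^{2n} Π_j dμ = (2n−1)‼·⟨f, G_k f⟩ⁿ` (Glimm–Jaffe (3.2.12) for the law of the
multiscale field, *"the field A′ has the covariance G_k"*). [cite: Balaban1983Higgs3, (1.4) p.414] -/
theorem integral_fluctSum_pow_two_mul (hmsq : 0 < msq) (ha : 0 < a) (hL : 1 < (P.L : ℝ)) {k : ℕ} (hk1 : 1 ≤ k)
    (hk : k ≤ P.K) (f : HiggsLattice.VecField P 0) (n : ℕ) :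
    ∫ F, siteInner (toSite (∑ j : Fin k, fluctPiece msq a j (F j))) (toSite f) ^ (2 * n) ∂(fluctFamily P msq a k)
      = ((2 * n - 1)‼ : ℕ) * siteInner (toSite f) (vecG P msq a k (toSite f)) ^ n := by
  have h := integral_prodPairs_eq_wickSum hmsq ha hL hk1 hk (fun _ : Fin (2 * n) => f) univ
  simp only [prod_const, card_univ, Fintype.card_fin] at h
  rw [h, wickSum_const_eq _ (by rw [card_univ, Fintype.card_fin]; exact even_two_mul n), card_univ, Fintype.card_fin,
    Nat.mul_div_cancel_left _ two_pos]

/-- The odd moments of one leg of `A′` vanish. [cite: Balaban1983Higgs3, (1.4) p.414] -/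
theorem integral_fluctSum_pow_odd (hmsq : 0 < msq) (ha : 0 < a) (hL : 1 < (P.L : ℝ)) {k : ℕ} (hk1 : 1 ≤ k) (hk : k ≤ P.K)
    (f : HiggsLattice.VecField P 0) (n : ℕ) :
    ∫ F, siteInner (toSite (∑ j : Fin k, fluctPiece msq a j (F j))) (toSite f) ^ (2 * n + 1) ∂(fluctFamily P msq a k) = 0 := by
  have h := integral_prodPairs_eq_zero_of_odd hmsq ha hL hk1 hk (fun _ : Fin (2 * n + 1) => f)
    (s := univ) (by rw [card_univ, Fintype.card_fin]; exact odd_two_mul_add_one n)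
  simpa only [prod_const, card_univ, Fintype.card_fin] using h

/-- **THE TRUNCATED EXPECTATIONS OF PRODUCTS OF `A′`-LEGS ARE THE SUMS OVER THE CONNECTED PAIRINGS WITH PROPAGATOR `G_k`**
(p. 416 *"graphs of the expansion of G^ε"*, for the actual multiscale Gaussian field of (1.4)). [cite: Balaban1983Higgs3, (1.21) p.416] -/
theorem ursellOf_integral_prodPairs_eq_sum_connected (hmsq : 0 < msq) (ha : 0 < a) (hL : 1 < (P.L : ℝ)) {k : ℕ} (hk1 : 1 ≤ k)
    (hk : k ≤ P.K) {J : Type*} [DecidableEq J] {Λ : Type*} [Fintype Λ] [LinearOrder Λ] (f : Λ → HiggsLattice.VecField P 0)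
    (own : Λ → J) {V : Finset (Option J)} (hV : V.Nonempty) :
    ursellOf (fun Q => ∫ F, ∏ i ∈ legs own Q, siteInner (toSite (∑ j : Fin k, fluctPiece msq a j (F j))) (toSite (f i))
        ∂(fluctFamily P msq a k)) V
      = ∑ g ∈ (diags own V).filter (IsConn own V),
          dval (pairVal (fun a' b' => siteInner (toSite (f b')) (vecG P msq a k (toSite (f a'))))) obsW V g := by
  have h : (fun Q => ∫ F, ∏ i ∈ legs own Q, siteInner (toSite (∑ j : Fin k, fluctPiece msq a j (F j))) (toSite (f i))
        ∂(fluctFamily P msq a k))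
      = fun Q => wickSum (fun a' b' => siteInner (toSite (f b')) (vecG P msq a k (toSite (f a')))) (legs own Q) :=
    funext fun Q => integral_prodPairs_eq_wickSum hmsq ha hL hk1 hk f _
  rw [h, ursellOf_wickSum_legs own _ hV]

end FluctSum

/-! ## §3 The scalar fluctuation `χ` on `Ω = B^k(Ω^{(k)})` (propagator `G_k(Ω,B̃)`, `B3ScalarPropagatorWickSum`) -/

section Scalar

open B3Eq14AuxFunction (region extendZero)
open HiggsCovariance (covOpK propagatorK)
open B3ScalarPropagatorWickSum (integral_prodExtLegs_eq_wickSum)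

variable {P : HiggsLattice.Params} {N : ℕ} (C : ChargeData N) (A : HiggsLattice.VecField P 0) {k : ℕ}
  (Ωk : Finset (HiggsLattice.Site P k)) {msq : ℝ} (a : ℝ) {ι : Type*} [LinearOrder ι]

/-- **THE WICK INTEGRAL OF THE SCALAR FLUCTUATION AS A SUM OVER PAIR PARTITIONS**: for legs `f_i` supported in `Ω`,
`∫ Π_{i∈s}⟨χ̃,f_i⟩e^{−½⟨χ̃,G_k^{−1}χ̃⟩}dχ = (Σ_{π ∈ pairPartitions s} Π_{{a<b}∈π} ⟨f_b, G_k(Ω,B̃)f_a⟩)·∫e^{−½⟨χ̃,G_k^{−1}χ̃⟩}dχ`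
(`msq > 0`, `a_k ≥ 0`; the typer g30's `integral_prodExtLegs_eq_wickSum` rewritten). [cite: Balaban1983Higgs3, (1.4) p.414] -/
theorem integral_prodExtLegs_eq_sum_pairPartitions (hmsq : 0 < msq) (hak : 0 ≤ B1.aSeq a P.L k)
    {f : ι → HiggsLattice.ScalarField P 0 N} (hf : ∀ i x, x ∉ region k Ωk → f i x = 0) (s : Finset ι) :
    ∫ χ, (∏ i ∈ s, siteInner (extendZero (region k Ωk) χ) (f i))
        * Real.exp (-(1 / 2 : ℝ) * siteInner (extendZero (region k Ωk) χ)
            (covOpK C (region k Ωk) A msq a k (extendZero (region k Ωk) χ)))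
      = (∑ π ∈ pairPartitions s, ∏ Bl ∈ π,
            pairVal (fun a' b' => siteInner (f b') (propagatorK C (region k Ωk) A msq a k (f a'))) Bl)
        * ∫ χ, Real.exp (-(1 / 2 : ℝ) * siteInner (extendZero (region k Ωk) χ)
            (covOpK C (region k Ωk) A msq a k (extendZero (region k Ωk) χ))) := by
  rw [integral_prodExtLegs_eq_wickSum C A Ωk a hmsq hak hf s, wickSum_eq_sum_pairPartitions_pairVal]

/-- An odd number of legs of `χ` gives `0`. [cite: Balaban1983Higgs3, (1.4) p.414] -/
theorem integral_prodExtLegs_eq_zero_of_odd (hmsq : 0 < msq) (hak : 0 ≤ B1.aSeq a P.L k)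
    {f : ι → HiggsLattice.ScalarField P 0 N} (hf : ∀ i x, x ∉ region k Ωk → f i x = 0) {s : Finset ι} (hs : Odd s.card) :
    ∫ χ, (∏ i ∈ s, siteInner (extendZero (region k Ωk) χ) (f i))
        * Real.exp (-(1 / 2 : ℝ) * siteInner (extendZero (region k Ωk) χ)
            (covOpK C (region k Ωk) A msq a k (extendZero (region k Ωk) χ))) = 0 := by
  rw [integral_prodExtLegs_eq_wickSum C A Ωk a hmsq hak hf s, wickSum_eq_zero_of_odd _ hs, zero_mul]

end Scalar

/-! ## §4 (v1.1) The Gaussian product-moment bound on the law of (3.56): `|∫ Π_{i∈T} legs| ≤ (|T|−1)‼·Π_i σ_i`, and its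
## volume- and scale-uniform form `≤ (|T|−1)‼·σ^{|T|}` from the Prop. 2.3 (2.33) lower halves of the two factors -/

section Law356MomentBound

open HiggsFluctMeasureWickMomentBound (abs_wickSum_le_doubleFactorial_mul_prod abs_inv_mulVec_dotProduct_le
  inv_mulVec_dotProduct_self_nonneg)
open B1Eq324SmallFieldLeaf (bondVar siteVar bondDelta siteDelta bondVar_le_of_ineq233_lower' siteVar_le_of_ineq233_lower')
open HiggsCondCov232 (condCov232)
open HiggsFluctMeasure (precOp)
open B1Eq230FluctCov (precOpA)
open B1Eq324SmallFieldLeafModels (bondVar_le_zeroField siteVar_le_zeroField)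
open B2Prop31ZeroFieldConcrete (gamma0)

variable {P : HiggsLattice.Params} {N : ℕ} (C : ChargeData N) (Ω : Finset (HiggsLattice.Site P 0)) (B : HiggsLattice.VecField P 0)
  {μ0sq msq a : ℝ} {k : ℕ}

/-- The diagonal of r14's propagator kernel at a vector leg is r14's bond variance `bondVar` ((2.30) in the pairing (1.5)).
[cite: Balaban1982Higgs1, (2.30) p.611] -/
theorem propKer_inr_self (μ0sq msq a : ℝ) (k : ℕ) (μ : Fin P.d) (y : HiggsLattice.Site P k) :
    propKer C Ω B μ0sq msq a k (Sum.inr μ) y (Sum.inr μ) y = bondVar P μ0sq a k ⟨y, μ⟩ := rfl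

/-- The diagonal of r14's propagator kernel at a scalar leg is r14's site variance `siteVar` on the whole lattice `Λ = T^{(k)}` ((2.32) in
the pairing (1.5)). [cite: Balaban1982Higgs1, (2.32) p.611] -/
theorem propKer_inl_self (μ0sq msq a : ℝ) (k : ℕ) (j : Fin N) (y : HiggsLattice.Site P k) :
    propKer C Ω B μ0sq msq a k (Sum.inl j) y (Sum.inl j) y
      = siteVar P C Ω B msq a k (Finset.univ : Finset (HiggsLattice.Site P k)) y j := rfl

/-- The rescaled diagonal `(L^kε)^{d−2}·propKer l y l y` is the variance of the leg `(l, y)` under the law of (3.56), hence `≥ 0`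
(`μ₀², m² > 0`, `a > 0`, `L > 1`, `k ≤ K`). [cite: Balaban1982Higgs1, (3.56) p.622] -/
theorem mesh_pow_mul_propKer_self_nonneg (hμ : 0 < μ0sq) (hmsq : 0 < msq) (ha : 0 < a) (hL : 1 < (P.L : ℝ)) (hk : k ≤ P.K)
    (l : Leg N P.d) (y : HiggsLattice.Site P k) :
    0 ≤ P.mesh k ^ ((P.d : ℝ) - 2) * propKer C Ω B μ0sq msq a k l y l y := by
  classical
  rw [← inv_blockPrec_legVecS_dotProduct C Ω B hμ hmsq ha hL hk]
  exact inv_mulVec_dotProduct_self_nonneg (blockPrec_posDef C Ω B hμ hmsq ha hL hk) _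

/-- The diagonal of the propagator kernel is nonnegative: `0 ≤ propKer l y l y`. [cite: Balaban1982Higgs1, (2.30) p.611; (2.32) p.611] -/
theorem propKer_self_nonneg (hμ : 0 < μ0sq) (hmsq : 0 < msq) (ha : 0 < a) (hL : 1 < (P.L : ℝ)) (hk : k ≤ P.K)
    (l : Leg N P.d) (y : HiggsLattice.Site P k) :
    0 ≤ propKer C Ω B μ0sq msq a k l y l y :=
  (mul_nonneg_iff_of_pos_left (Real.rpow_pos_of_pos (P.mesh_pos k) _)).1
    (mesh_pow_mul_propKer_self_nonneg C Ω B hμ hmsq ha hL hk l y)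

/-- **CAUCHY–SCHWARZ FOR THE PAIR VALUES OF THE LAW OF (3.56)** (rescaled form): `|(L^kε)^{d−2}propKer l y l′ y′| ≤
((L^kε)^{d−2}propKer l y l y)^{1/2}·((L^kε)^{d−2}propKer l′ y′ l′ y′)^{1/2}` — the covariance of p13's presentation is a
nonnegative symmetric form (the typer g35's `abs_inv_mulVec_dotProduct_le`). [cite: GlimmJaffeQP1987, (8.2.4) §8.2] -/
theorem abs_mesh_pow_mul_propKer_le (hμ : 0 < μ0sq) (hmsq : 0 < msq) (ha : 0 < a) (hL : 1 < (P.L : ℝ)) (hk : k ≤ P.K)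
    (l l' : Leg N P.d) (y y' : HiggsLattice.Site P k) :
    |P.mesh k ^ ((P.d : ℝ) - 2) * propKer C Ω B μ0sq msq a k l y l' y'|
      ≤ Real.sqrt (P.mesh k ^ ((P.d : ℝ) - 2) * propKer C Ω B μ0sq msq a k l y l y)
        * Real.sqrt (P.mesh k ^ ((P.d : ℝ) - 2) * propKer C Ω B μ0sq msq a k l' y' l' y') := by
  classical
  rw [← inv_blockPrec_legVecS_dotProduct C Ω B hμ hmsq ha hL hk, ← inv_blockPrec_legVecS_dotProduct C Ω B hμ hmsq ha hL hk,
    ← inv_blockPrec_legVecS_dotProduct C Ω B hμ hmsq ha hL hk]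
  exact abs_inv_mulVec_dotProduct_le (blockPrec_posDef C Ω B hμ hmsq ha hL hk) _ _

/-- **CAUCHY–SCHWARZ FOR THE PROPAGATOR KERNEL ITSELF**: `|propKer l y l′ y′| ≤ (propKer l y l y)^{1/2}·(propKer l′ y′ l′ y′)^{1/2}` — for
two vector legs `|C^{(k)}(b,b′)| ≤ C^{(k)}(b,b)^{1/2}C^{(k)}(b′,b′)^{1/2}` (2.30), for two scalar legs the same for `C^{(k)}(B^{(k+1)})`
(2.32), trivially for a mixed pair. [cite: Balaban1982Higgs1, (2.30) p.611; (2.32) p.611] -/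
theorem abs_propKer_le (hμ : 0 < μ0sq) (hmsq : 0 < msq) (ha : 0 < a) (hL : 1 < (P.L : ℝ)) (hk : k ≤ P.K)
    (l l' : Leg N P.d) (y y' : HiggsLattice.Site P k) :
    |propKer C Ω B μ0sq msq a k l y l' y'|
      ≤ Real.sqrt (propKer C Ω B μ0sq msq a k l y l y) * Real.sqrt (propKer C Ω B μ0sq msq a k l' y' l' y') := by
  have hm : 0 < P.mesh k ^ ((P.d : ℝ) - 2) := Real.rpow_pos_of_pos (P.mesh_pos k) _
  have h := abs_mesh_pow_mul_propKer_le C Ω B hμ hmsq ha hL hk l l' y y'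
  rw [abs_mul, abs_of_pos hm, Real.sqrt_mul hm.le, Real.sqrt_mul hm.le,
    mul_mul_mul_comm, ← Real.sqrt_mul hm.le, Real.sqrt_mul_self hm.le] at h
  exact le_of_mul_le_mul_left h hm

/-- **THE GAUSSIAN PRODUCT-MOMENT BOUND FOR THE LAW OF (3.56)**: under `dμ_{C^{(k)}}(A′)dμ_{C^{(k)}(B^{(k+1)})}(φ′)` every mixed moment of
the unit-lattice legs (1.22)/(3.57) obeys `|∫ Π_{i∈T} legVal(lab i)| ≤ (|T|−1)‼·Π_{i∈T} σ_i`, `σ_i² = (L^kε)^{d−2}·propKer (lab i) (lab i)`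
the variance of the `i`-th leg — each of the `(|T|−1)‼` pairings of §1's Wick form (Glimm–Jaffe (3.2.13)) is dominated through
Cauchy–Schwarz by `Π σ_i` (the typer g35's `abs_wickSum_le_doubleFactorial_mul_prod`) (`μ₀², m² > 0`, `a > 0`, `L > 1`, `k ≤ K`).
[cite: Balaban1982Higgs1, (3.56) p.622; p.617] [cite: GlimmJaffeQP1987, (8.2.4) §8.2] -/
theorem abs_integral_prod_legVal_law356_le (hμ : 0 < μ0sq) (hmsq : 0 < msq) (ha : 0 < a) (hL : 1 < (P.L : ℝ))
    (hk : k ≤ P.K) {ι : Type} [LinearOrder ι] (lab : ι → Leg N P.d × HiggsLattice.Site P k) (T : Finset ι) :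
    |∫ ω, ∏ i ∈ T, legVal k ω.1 (fieldOfCrd Finset.univ ω.2) (lab i).1 (lab i).2 ∂(law356 C Ω B μ0sq msq a k)|
      ≤ ((T.card - 1)‼ : ℕ) * ∏ i ∈ T, Real.sqrt (P.mesh k ^ ((P.d : ℝ) - 2)
          * propKer C Ω B μ0sq msq a k (lab i).1 (lab i).2 (lab i).1 (lab i).2) := by
  rw [integral_prod_legVal_law356_eq_wickSum C Ω B hμ hmsq ha hL hk lab T]
  exact abs_wickSum_le_doubleFactorial_mul_prod
    (fun i _ i' _ _ => abs_mesh_pow_mul_propKer_le C Ω B hμ hmsq ha hL hk (lab i).1 (lab i').1 (lab i).2 (lab i').2)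
    (fun _ _ => Real.sqrt_nonneg _)

/-- **THE UNIFORM FORM UNDER VARIANCE BOUNDS**: if every bond variance satisfies `bondVar b ≤ σ_A²(L^kε)^{−(d−2)}` and every site variance
(on `Λ = T^{(k)}`) `siteVar y j ≤ σ_φ²(L^kε)^{−(d−2)}` — the currency of r14's `B1Eq324SmallFieldLeaf.{bondVar,siteVar}_le_of_ineq233_lower'`
— then `|∫ Π_{i∈T} legVal(lab i) d(law356)| ≤ (|T|−1)‼·(max(σ_A², σ_φ²))^{|T|/2}`: the leg normalisation `(L^kε)^{(d−2)/2}` of (1.22)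
cancels the level factor, so the bound is independent of `k`, `ε`, the volume and the positions of the legs.
[cite: Balaban1982Higgs1, (3.56) p.622; (1.22) p.607; Prop. 2.3 (2.33) p.611] -/
theorem abs_integral_prod_legVal_law356_le_of_var (hμ : 0 < μ0sq) (hmsq : 0 < msq) (ha : 0 < a) (hL : 1 < (P.L : ℝ))
    (hk : k ≤ P.K) {σA σφ : ℝ}
    (hvarA : ∀ b : HiggsLattice.PBond P k, bondVar P μ0sq a k b ≤ σA * P.mesh k ^ (-((P.d : ℝ) - 2)))
    (hvarφ : ∀ (y : HiggsLattice.Site P k) (j : Fin N),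
      siteVar P C Ω B msq a k (Finset.univ : Finset (HiggsLattice.Site P k)) y j ≤ σφ * P.mesh k ^ (-((P.d : ℝ) - 2)))
    {ι : Type} [LinearOrder ι] (lab : ι → Leg N P.d × HiggsLattice.Site P k) (T : Finset ι) :
    |∫ ω, ∏ i ∈ T, legVal k ω.1 (fieldOfCrd Finset.univ ω.2) (lab i).1 (lab i).2 ∂(law356 C Ω B μ0sq msq a k)|
      ≤ ((T.card - 1)‼ : ℕ) * Real.sqrt (max σA σφ) ^ T.card := by
  refine (abs_integral_prod_legVal_law356_le C Ω B hμ hmsq ha hL hk lab T).trans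
    (mul_le_mul_of_nonneg_left ?_ (Nat.cast_nonneg _))
  rw [← prod_const]
  refine prod_le_prod (fun _ _ => Real.sqrt_nonneg _) fun i _ => Real.sqrt_le_sqrt ?_
  have hs : 0 < P.mesh k := P.mesh_pos k
  have hss : P.mesh k ^ ((P.d : ℝ) - 2) * P.mesh k ^ (-((P.d : ℝ) - 2)) = 1 := by
    rw [← Real.rpow_add hs, add_neg_cancel, Real.rpow_zero]
  have hm : 0 ≤ P.mesh k ^ ((P.d : ℝ) - 2) := (Real.rpow_pos_of_pos hs _).le
  have key : ∀ {c v : ℝ}, v ≤ c * P.mesh k ^ (-((P.d : ℝ) - 2)) → c ≤ max σA σφ →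
      P.mesh k ^ ((P.d : ℝ) - 2) * v ≤ max σA σφ := by
    intro c v hv hc
    calc P.mesh k ^ ((P.d : ℝ) - 2) * v ≤ P.mesh k ^ ((P.d : ℝ) - 2) * (c * P.mesh k ^ (-((P.d : ℝ) - 2))) :=
          mul_le_mul_of_nonneg_left hv hm
      _ = c * (P.mesh k ^ ((P.d : ℝ) - 2) * P.mesh k ^ (-((P.d : ℝ) - 2))) := by ring
      _ ≤ max σA σφ := by rw [hss, mul_one]; exact hc
  obtain ⟨l, y⟩ := lab i
  rcases l with j | μ
  · exact key (by rw [propKer_inl_self]; exact hvarφ y j) (le_max_right _ _)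
  · exact key (by rw [propKer_inr_self]; exact hvarA ⟨y, μ⟩) (le_max_left _ _)

/-- **THE UNIFORM FORM FROM PROP. 2.3 (2.33)**: the (2.33) lower halves `γ_A(L^kε)^{−2}‖f‖² ≤ ⟨f,(a(L^{k+1}ε)^{−2}P + Δ^{(k)})f⟩` for the
operator of `dμ_{C^{(k)}}(A′)` and `γ_φ(L^kε)^{−2}‖f‖² ≤ ⟨f,(a(L^{k+1}ε)^{−2}P(B) + Δ^{(k)}(Ω,B))f⟩` for the operator of `dμ_{C^{(k)}(B^{(k+1)})}(φ′)`
(INPUTS — Prop. 2.3 as printed; row B1.Prop2.3 supplies instances, e.g. p29's `B1Eq324SmallFieldLeafModels`) give, through r14's variance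
bounds `bondVar ≤ γ_A⁻¹(L^kε)^{−(d−2)}`, `siteVar ≤ γ_φ⁻¹(L^kε)^{−(d−2)}`, the bound `|∫ Π_{i∈T} legVal(lab i) d(law356)| ≤
(|T|−1)‼·(max(γ_A⁻¹, γ_φ⁻¹))^{|T|/2}` — every mixed moment of the rescaled fluctuation legs is `O(1)` with print's *"constants uniform in
k, Λ, A"*. [cite: Balaban1982Higgs1, Prop. 2.3 (2.33) p.611; (3.56) p.622] -/
theorem abs_integral_prod_legVal_law356_le_of_ineq233 (hμ : 0 < μ0sq) (hmsq : 0 < msq) (ha : 0 < a) (hL : 1 < (P.L : ℝ))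
    (hk : k ≤ P.K) {γA γφ : ℝ} (hγA : 0 < γA) (hγφ : 0 < γφ)
    (h233A : ∀ f : HiggsLattice.ScalarField P k P.d,
      γA * (P.mesh k)⁻¹ ^ 2 * siteInner f f ≤ siteInner f (precOp P μ0sq a k f))
    (h233φ : ∀ f : HiggsLattice.ScalarField P k N,
      γφ * (P.mesh k)⁻¹ ^ 2 * siteInner f f ≤ siteInner f (precOpA C Ω B msq a k f))
    {ι : Type} [LinearOrder ι] (lab : ι → Leg N P.d × HiggsLattice.Site P k) (T : Finset ι) :
    |∫ ω, ∏ i ∈ T, legVal k ω.1 (fieldOfCrd Finset.univ ω.2) (lab i).1 (lab i).2 ∂(law356 C Ω B μ0sq msq a k)|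
      ≤ ((T.card - 1)‼ : ℕ) * Real.sqrt (max γA⁻¹ γφ⁻¹) ^ T.card :=
  abs_integral_prod_legVal_law356_le_of_var C Ω B hμ hmsq ha hL hk
    (bondVar_le_of_ineq233_lower' (P := P) hμ ha hL hk hγA h233A)
    (siteVar_le_of_ineq233_lower' C Ω B hmsq ha hL hk Finset.univ hγφ h233φ) lab T

/-- **HYPOTHESIS-FREE AT ZERO BACKGROUND ON THE WHOLE TORUS** (`Ω = T_ε`, `B = 0`, any charge data `C`; `μ₀², m² > 0`, `a > 0`, `L > 1`,
`k < K`, `L^kε ≤ 1`): with p15's `γ₀(a, ·)` of the zero-field (2.33)ₗ (`B2Prop31ZeroFieldConcrete.gamma0`) and p29's hypothesis-free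
variance bounds `bondVar_le_zeroField` / `siteVar_le_zeroField` (`σ² = L²/min{a, 8γ₀}`),
`|∫ Π_{i∈T} legVal(lab i) d(law356 C T_ε 0)| ≤ (|T|−1)‼·(max(L²/min{a,8γ₀(a,μ₀²)}, L²/min{a,8γ₀(a,m²)}))^{|T|/2}` — independent of `k`, `ε`
and the volume. [cite: Balaban1982Higgs1, Prop. 2.3 (2.33) p.611; (3.56) p.622] -/
theorem abs_integral_prod_legVal_law356_le_zeroField (hμ : 0 < μ0sq) (hmsq : 0 < msq) (ha : 0 < a) (hL : 1 < P.L)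
    (hk : k < P.K) (hs : P.mesh k ≤ 1)
    {ι : Type} [LinearOrder ι] (lab : ι → Leg N P.d × HiggsLattice.Site P k) (T : Finset ι) :
    |∫ ω, ∏ i ∈ T, legVal k ω.1 (fieldOfCrd Finset.univ ω.2) (lab i).1 (lab i).2
        ∂(law356 C (Finset.univ : Finset (HiggsLattice.Site P 0)) (0 : HiggsLattice.VecField P 0) μ0sq msq a k)|
      ≤ ((T.card - 1)‼ : ℕ) * Real.sqrt (max (min a (8 * gamma0 P a μ0sq) / (P.L : ℝ) ^ 2)⁻¹
          (min a (8 * gamma0 P a msq) / (P.L : ℝ) ^ 2)⁻¹) ^ T.card := by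
  have hLr : (1 : ℝ) < (P.L : ℝ) := by exact_mod_cast hL
  exact abs_integral_prod_legVal_law356_le_of_var C Finset.univ 0 hμ hmsq ha hLr hk.le
    (bondVar_le_zeroField (P := P) hμ ha hL hk hs)
    (siteVar_le_zeroField C hmsq ha hL hk hs Finset.univ) lab T

/-- One leg, even power, uniform: `∫ legVal(l,y)^{2n} d(law356) ≤ (2n−1)‼·(max(σ_A²,σ_φ²))ⁿ` under the variance bounds of
`abs_integral_prod_legVal_law356_le_of_var` (the `2n`-th moment is `(2n−1)‼σ²ⁿ` by §1). [cite: Balaban1982Higgs1, (3.56) p.622] -/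
theorem integral_legVal_pow_two_mul_law356_le_of_var (hμ : 0 < μ0sq) (hmsq : 0 < msq) (ha : 0 < a) (hL : 1 < (P.L : ℝ))
    (hk : k ≤ P.K) {σA σφ : ℝ} (hσA : 0 ≤ σA)
    (hvarA : ∀ b : HiggsLattice.PBond P k, bondVar P μ0sq a k b ≤ σA * P.mesh k ^ (-((P.d : ℝ) - 2)))
    (hvarφ : ∀ (y : HiggsLattice.Site P k) (j : Fin N),
      siteVar P C Ω B msq a k (Finset.univ : Finset (HiggsLattice.Site P k)) y j ≤ σφ * P.mesh k ^ (-((P.d : ℝ) - 2)))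
    (l : Leg N P.d) (y : HiggsLattice.Site P k) (n : ℕ) :
    ∫ ω, legVal k ω.1 (fieldOfCrd Finset.univ ω.2) l y ^ (2 * n) ∂(law356 C Ω B μ0sq msq a k)
      ≤ ((2 * n - 1)‼ : ℕ) * (max σA σφ) ^ n := by
  have h := abs_integral_prod_legVal_law356_le_of_var C Ω B hμ hmsq ha hL hk hvarA hvarφ (fun _ : Fin (2 * n) => (l, y))
    Finset.univ
  simp only [prod_const, card_univ, Fintype.card_fin] at h
  have hmax : 0 ≤ max σA σφ := hσA.trans (le_max_left _ _)
  rw [pow_mul, Real.sq_sqrt hmax] at h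
  exact (le_abs_self _).trans h

end Law356MomentBound

end

end Literature.MathematicalPhysics.QuantumFieldTheory.Balaban1983to89.HiggsFluctMeasureWickPairingsModels
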